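import Mathlib.Data.Finset.Preimage
import Literature.ModelTheory.UniversalTheories.HerbrandSaturation
import Literature.ModelTheory.ModelCompleteness.RobinsonTest
import Literature.ModelTheory.ExponentialFields.PrenexExistential
import Literature.ModelTheory.ExponentialFields.ModelTheoryPredsProofs
import HarnessLib

/-!
# The existential preservation theorem and Robinson's test

We prove the direction `⇒` of **Robinson's test** — the named fact
`FirstOrder.Language.Theory.isModelComplete_iff_forall_exists_isExistential` of
`Literature/ModelTheory/ExponentialFields/ModelTheoryPreds.lean` (Marker, *Model Theory: An
Introduction* (2002), Prop. 3.1.12, the locator carried by the fact; A. Robinson 1956; the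
equivalence is also in Chang–Keisler, *Model Theory*, §3.5, and Hodges, *Model Theory*, §8.3): if
`T` is model complete then every formula is
`T`-equivalent to an existential formula — and thereby discharge that fact
(`isModelComplete_iff_forall_exists_isExistential_holds`; the direction `⇐` is
`IsModelComplete.of_forall_exists_isExistential`, `ModelTheoryPredsProofs.lean`). This syntactic
form of Robinson's test is complementary to the form "existentially closed ⇒ model complete"
proved in `Literature/ModelTheory/ModelCompleteness/RobinsonTest.lean` (`Literature.ModelTheory.ModelCompleteness.robinsonTest_holds`),
whose diagram lemma `embeddingOfRealizeQF` and finite-conjunction lemmas are reused here.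

The substance is the **existential preservation theorem** (the dual form of the Łoś–Tarski
theorem on universal formulas and substructures; Chang–Keisler §3.2, Hodges §6.5): a formula
`φ(x̄)` that is preserved by embeddings between models of `T` is `T`-equivalent to an existential
formula
(`exists_isExistential_iff_of_preserved`). Proof (the textbook one, diagrams and compactness):
let `Ψ` be the existential formulas `T`-implying `φ`.
* (`exists_exBelow_realize_of_preserved`) If `N ⊨ T` and `N ⊨ φ(ā)` then some `ψ ∈ Ψ` holds at
  `ā`: consider `T`, the quantifier-free diagram of `N` and `¬φ(ā)`, as a theory about constants
  naming `N` (`isSatisfiable_union_image_equivSentence_iff`, `HerbrandSaturation.lean`). A model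
  `K` would come with a map `N → K` preserving quantifier-free formulas with parameters, i.e. an
  embedding (`Literature.ModelTheory.ModelCompleteness.embeddingOfRealizeQF`, `ModelCompleteness/RobinsonTest.lean`),
  along which `φ(ā)` is preserved — contradiction; so it is
  unsatisfiable, and by compactness finitely many true quantifier-free `θᵢ(ā, b̄)` already force
  `φ(ā)` in every model; turning the parameters into variables (`restrictFreeVar`) and
  quantifying the `b̄` existentially (`exs`) gives `ψ := ∃ ȳ (⋀ θᵢ(x̄', ȳ) ∧ x̄ = x̄')` in `Ψ`, true at
  `ā` (`exists_isExistential_of_param`).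
* Hence `T ∪ {φ(c̄)} ∪ {¬ψ(c̄) | ψ ∈ Ψ}` is unsatisfiable; by compactness `φ` `T`-implies a finite
  disjunction of members of `Ψ`, which is `T`-equivalent to one existential formula
  (`IsExistential.exists_iff_foldr_sup`, `PrenexExistential.lean`).

## Main statements

* `FirstOrder.Language.Theory.exists_isExistential_iff_of_preserved` (existential preservation)
  [cite: Marker2002, Prop. 3.1.12];
* `FirstOrder.Language.Theory.IsModelComplete.exists_isExistential_iff` and
  `isModelComplete_iff_forall_exists_isExistential_holds` (Robinson's test) [cite: Marker2002, Prop. 3.1.12].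
-/

universe u v w w'

open FirstOrder FirstOrder.Language FirstOrder.Language.BoundedFormula Set


/-! ## Syntactic helpers -/

namespace FirstOrder.Language.BoundedFormula

variable {L : Language.{u, v}} {α : Type w} {n : ℕ}

/-- `BoundedFormula.not` is injective. [folklore] -/
theorem not_injective : Function.Injective (BoundedFormula.not : L.BoundedFormula α n → _) :=
  fun _ _ h => (BoundedFormula.imp.inj h).1

/-- Existentially closing the bound variables of an existential formula gives an existential
formula. [folklore] -/
theorem IsExistential.exs : ∀ {n : ℕ} {φ : L.BoundedFormula α n}, φ.IsExistential → φ.exs.IsExistential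
  | 0, _, h => h
  | _ + 1, φ, h => by
    rw [BoundedFormula.exs]
    exact IsExistential.exs h.ex

end FirstOrder.Language.BoundedFormula

/-! ## The existential preservation theorem -/

namespace FirstOrder.Language.Theory

open Literature.ModelTheory.UniversalTheories Literature.ModelTheory.ModelCompleteness

variable {L : Language.{u, v}} {T : L.Theory} {n : ℕ}

/-- `φ(x̄)` is *preserved by embeddings between models of `T`* (the models ranging over
`Theory.ModelType.{u, v, max u v} T`, as in `Theory.IsModelComplete`). [folklore] -/
def PreservedUnderEmbeddings (T : L.Theory) (φ : L.Formula (Fin n)) : Prop :=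
  ∀ (M N : ModelType.{u, v, max u v} T) (f : M ↪[L] N) (x : Fin n → M),
    φ.Realize x → φ.Realize (f ∘ x)

/-- In a model complete theory every formula is preserved by embeddings between models. [folklore] -/
theorem IsModelComplete.preservedUnderEmbeddings (h : T.IsModelComplete) (φ : L.Formula (Fin n)) :
    T.PreservedUnderEmbeddings φ :=
  fun M N f x hx => (h M N f n φ x).2 hx

/-- The *existential type below `φ`*: existential formulas `T`-implying `φ`. [folklore] -/
def exBelow (T : L.Theory) (φ : L.Formula (Fin n)) : Set (L.Formula (Fin n)) :=
  {ψ | ψ.IsExistential ∧ (ψ ⟹[T] φ)}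

/-- **Parameters to variables.** Let `N ⊨ T`, `ā ∈ Nⁿ`, and let `θ` be a quantifier-free formula
with parameters from `N`, true in `N`, such that in every model `K ⊨ T`, every assignment
`w : N → K` of the parameters satisfying `θ` satisfies `φ(w ā)`. Then some existential formula
`ψ(x̄)` — namely `∃ ȳ (θ(ȳ) ∧ ⋀ᵢ xᵢ = y_{j i})`, the parameters replaced by the variables `ȳ` —
`T`-implies `φ` and holds at `ā`. [folklore] -/
theorem exists_isExistential_of_param {φ : L.Formula (Fin n)} (N : Type (max u v))
    [L.Structure N] [Nonempty N] [N ⊨ T] (v : Fin n → N) (θ : L.Formula N) (hθ : θ.IsQF)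
    (hθN : θ.Realize (id : N → N))
    (hcons : ∀ (K : Type (max u v)) [L.Structure K] [Nonempty K] [K ⊨ T] (w : N → K),
      θ.Realize w → φ.Realize (w ∘ v)) :
    ∃ ψ : L.Formula (Fin n), ψ.IsExistential ∧ (ψ ⟹[T] φ) ∧ ψ.Realize v := by
  classical
  -- the finitely many parameters that matter, numbered by `Fin k`
  let s : Finset N := θ.freeVarFinset ∪ Finset.univ.image v
  let k : ℕ := s.card
  let e : s ≃ Fin k := s.equivFin
  have hsub : ∀ a ∈ θ.freeVarFinset, a ∈ s := fun a ha => Finset.mem_union_left _ ha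
  have hv : ∀ i, v i ∈ s := fun i => Finset.mem_union_right _ (Finset.mem_image_of_mem v (Finset.mem_univ i))
  let f : θ.freeVarFinset → Fin k := fun a => e ⟨a, hsub a a.2⟩
  let j : Fin n → Fin k := fun i => e ⟨v i, hv i⟩
  -- `θ` with its parameters as free variables `Fin k`, then as bound variables
  let θ₁ : L.Formula (Fin k) := θ.restrictFreeVar f
  have hθ₁ : θ₁.IsQF := hθ.restrictFreeVar f
  let θ₂ : L.BoundedFormula (Fin n) k :=
    BoundedFormula.relabel (Sum.inr : Fin k → Fin n ⊕ Fin k) θ₁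
  have hθ₂ : θ₂.IsQF := hθ₁.relabel _
  have hθ₂r : ∀ (K : Type (max u v)) [L.Structure K] (c : Fin n → K) (ys : Fin k → K),
      θ₂.Realize c ys ↔ θ₁.Realize ys := by
    intro K _ c ys
    simp only [θ₂, BoundedFormula.realize_relabel, Sum.elim_comp_inr]
    unfold Formula.Realize
    exact iff_of_eq (congrArg₂ _ (funext fun i => rfl) (Subsingleton.elim _ _))
  have hθ₁r : ∀ (K : Type (max u v)) [L.Structure K] (ys : Fin k → K) (w : N → K),
      (∀ a (ha : a ∈ θ.freeVarFinset), ys (e ⟨a, hsub a ha⟩) = w a) → (θ₁.Realize ys ↔ θ.Realize w) := by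
    intro K _ ys w hw
    exact realize_restrictFreeVar w fun a => hw a a.2
  -- the equations `xᵢ = y_{j i}`
  let E : Fin n → L.BoundedFormula (Fin n) k := fun i =>
    (Term.var (Sum.inl i)).bdEqual (Term.var (Sum.inr (j i)))
  have hE : ∀ i, (E i).IsQF := fun i => (IsAtomic.equal _ _).isQF
  have hEr : ∀ (K : Type (max u v)) [L.Structure K] (c : Fin n → K) (ys : Fin k → K) (i : Fin n),
      (E i).Realize c ys ↔ c i = ys (j i) := by
    intro K _ c ys i
    simp [E]
  let θ₃ : L.BoundedFormula (Fin n) k := θ₂ ⊓ iInf E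
  have hθ₃ : θ₃.IsQF := hθ₂.inf (Literature.ModelTheory.ModelCompleteness.isQF_iInf hE)
  have hθ₃r : ∀ (K : Type (max u v)) [L.Structure K] (c : Fin n → K) (ys : Fin k → K),
      θ₃.Realize c ys ↔ θ₁.Realize ys ∧ ∀ i, c i = ys (j i) := by
    intro K _ c ys
    rw [realize_inf, hθ₂r, realize_iInf]
    exact and_congr Iff.rfl (forall_congr' fun i => hEr K c ys i)
  refine ⟨θ₃.exs, hθ₃.isExistential.exs, ?_, ?_⟩
  · -- `ψ ⟹[T] φ`
    intro M c xs hψ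
    obtain rfl : xs = default := Subsingleton.elim _ _
    obtain ⟨ys, hys⟩ := realize_exs.1 hψ
    obtain ⟨h1, h2⟩ := (hθ₃r M c ys).1 hys
    -- extend the assignment of the numbered parameters to all of `N`
    let w : N → M := fun p => if hp : p ∈ s then ys (e ⟨p, hp⟩) else Classical.arbitrary M
    have hw : ∀ a (ha : a ∈ θ.freeVarFinset), ys (e ⟨a, hsub a ha⟩) = w a := fun a ha => by
      simp only [w, dif_pos (hsub a ha)]
    have hθw : θ.Realize w := (hθ₁r M ys w hw).1 h1
    have hφ := hcons M w hθw
    have hwv : w ∘ v = c := funext fun i => by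
      simp only [Function.comp_apply, w, dif_pos (hv i)]
      exact (h2 i).symm
    rw [hwv] at hφ
    exact hφ
  · -- `N ⊨ ψ(ā)`: take the parameters themselves as witnesses
    refine realize_exs.2 ⟨fun m => ((e.symm m : s) : N), (hθ₃r N v _).2 ⟨?_, fun i => ?_⟩⟩
    · refine (hθ₁r N _ id fun a ha => ?_).2 hθN
      simp
    · simp [j]

/-- **The key step of the existential preservation theorem.** If `φ` is preserved by embeddings
between models of `T`, `N ⊨ T` and `N ⊨ φ(ā)`, then some existential formula `T`-implying `φ`
holds at `ā` (quantifier-free diagram of `N` plus `¬φ(ā)`: a model would be an extension of `N`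
refuting `φ(ā)`; so by compactness finitely many quantifier-free facts about `N` force `φ(ā)`). [cite: Marker2002, Prop. 3.1.12] -/
theorem exists_exBelow_realize_of_preserved {φ : L.Formula (Fin n)}
    (hpres : T.PreservedUnderEmbeddings φ) (N : Type (max u v)) [L.Structure N] [Nonempty N]
    [hNT : N ⊨ T] (v : Fin n → N) (hφ : φ.Realize v) :
    ∃ ψ ∈ T.exBelow φ, ψ.Realize v := by
  classical
  -- the quantifier-free diagram of `N` and `¬ φ(ā)`, as formulas with parameters from `N`
  let D : Set (L.Formula N) := {θ | θ.IsQF ∧ θ.Realize (id : N → N)}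
  let S : Set (L.Formula N) := D ∪ {(φ.relabel v).not}
  have hunsat : ¬ ((L.lhomWithConstants N).onTheory T ∪ Formula.equivSentence '' S).IsSatisfiable := by
    intro hsat
    obtain ⟨K, _, _, w, hKT, hS⟩ := (isSatisfiable_union_image_equivSentence_iff T S).1 hsat
    haveI : K ⊨ T := hKT
    have hw : ∀ θ : L.Formula N, θ.IsQF → θ.Realize (_root_.id : N → N) → θ.Realize w :=
      fun θ hθ hθid => hS θ (Or.inl ⟨hθ, hθid⟩)
    have h1 : ¬ φ.Realize (w ∘ v) := by
      have := hS _ (Or.inr rfl)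
      rwa [Formula.realize_not, Formula.realize_relabel] at this
    exact h1 (hpres (ModelType.of T N) (ModelType.of T K) (embeddingOfRealizeQF w hw) v hφ)
  -- compactness: a finite unsatisfiable part
  rw [isSatisfiable_iff_isFinitelySatisfiable, IsFinitelySatisfiable] at hunsat
  push Not at hunsat
  obtain ⟨T0, hT0, hT0sat⟩ := hunsat
  let D₀ : Finset (L.Formula N) :=
    (T0.preimage Formula.equivSentence (Formula.equivSentence.injective.injOn)).filter (· ∈ D)
  have hD₀D : ∀ θ ∈ D₀, θ ∈ D := fun θ hθ => (Finset.mem_filter.1 hθ).2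
  -- the finite part forces `φ(ā)` in every model
  have key : ∀ (K : Type (max u v)) [L.Structure K] [Nonempty K] [K ⊨ T] (w : N → K),
      (∀ θ ∈ D₀, θ.Realize w) → φ.Realize (w ∘ v) := by
    intro K _ _ _ w hw
    by_contra hφw
    apply hT0sat
    have hsat' : ((L.lhomWithConstants N).onTheory T ∪
        Formula.equivSentence '' (↑D₀ ∪ {(φ.relabel v).not})).IsSatisfiable :=
      isSatisfiable_union_image_equivSentence_of_realize T _ K w (by
        rintro θ (hθ | rfl)
        · exact hw θ hθ
        · rwa [Formula.realize_not, Formula.realize_relabel])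
    refine hsat'.mono fun σ hσ => ?_
    rcases hT0 hσ with hσ' | ⟨θ, hθS, rfl⟩
    · exact Or.inl hσ'
    · refine Or.inr ⟨θ, ?_, rfl⟩
      rcases hθS with hθD | hθφ
      · exact Or.inl (Finset.mem_filter.2 ⟨Finset.mem_preimage.2 hσ, hθD⟩)
      · exact Or.inr hθφ
  -- conjoin the finite part and turn the parameters into variables
  let θ : L.Formula N := D₀.toList.foldr (· ⊓ ·) ⊤
  have hθqf : θ.IsQF := Literature.ModelTheory.ModelCompleteness.isQF_foldr_inf fun χ hχ => (hD₀D χ (Finset.mem_toList.1 hχ)).1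
  have hθN : θ.Realize (id : N → N) :=
    (realize_foldr_inf _ _ _).2 fun χ hχ => (hD₀D χ (Finset.mem_toList.1 hχ)).2
  obtain ⟨ψ, hψ, himp, hv⟩ := exists_isExistential_of_param (T := T) N v θ hθqf hθN
    fun K _ _ _ w hθw => key K w fun χ hχ => (realize_foldr_inf _ _ _).1 hθw χ (Finset.mem_toList.2 hχ)
  exact ⟨ψ, ⟨hψ, himp⟩, hv⟩

/-- **Existential preservation theorem** (dual Łoś–Tarski; the argument of Marker 2002,
Prop. 3.1.12 / Chang–Keisler §3.2): a formula preserved by embeddings between models of `T` is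
`T`-equivalent to an existential formula. [cite: Marker2002, Prop. 3.1.12] -/
theorem exists_isExistential_iff_of_preserved (φ : L.Formula (Fin n))
    (hpres : T.PreservedUnderEmbeddings φ) :
    ∃ ψ : L.Formula (Fin n), ψ.IsExistential ∧ (φ ⇔[T] ψ) := by
  classical
  let Ψ : Set (L.Formula (Fin n)) := T.exBelow φ
  let S : Set (L.Formula (Fin n)) := {φ} ∪ BoundedFormula.not '' Ψ
  -- `T ∪ {φ(c̄)} ∪ {¬ψ(c̄) | ψ ∈ Ψ}` is unsatisfiable
  have hunsat : ¬ ((L.lhomWithConstants (Fin n)).onTheory T ∪ Formula.equivSentence '' S).IsSatisfiable := by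
    intro hsat
    obtain ⟨N, _, _, v, hNT, hS⟩ := (isSatisfiable_union_image_equivSentence_iff T S).1 hsat
    haveI : N ⊨ T := hNT
    obtain ⟨ψ, hψ, hψv⟩ := exists_exBelow_realize_of_preserved hpres N v (hS φ (Or.inl rfl))
    exact (Formula.realize_not.1 (hS ψ.not (Or.inr ⟨ψ, hψ, rfl⟩))) hψv
  -- compactness
  rw [isSatisfiable_iff_isFinitelySatisfiable, IsFinitelySatisfiable] at hunsat
  push Not at hunsat
  obtain ⟨T0, hT0, hT0sat⟩ := hunsat
  let Ψ₀ : Finset (L.Formula (Fin n)) :=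
    ((T0.preimage Formula.equivSentence (Formula.equivSentence.injective.injOn)).preimage
      BoundedFormula.not not_injective.injOn).filter (· ∈ Ψ)
  have hΨ₀Ψ : ∀ ψ ∈ Ψ₀, ψ ∈ Ψ := fun ψ hψ => (Finset.mem_filter.1 hψ).2
  -- in every model, `φ(x̄)` implies some member of `Ψ₀`
  have cover : ∀ (M : Type (max u v)) [L.Structure M] [Nonempty M] [M ⊨ T] (x : Fin n → M),
      φ.Realize x → ∃ ψ ∈ Ψ₀, ψ.Realize x := by
    intro M _ _ _ x hx
    by_contra hno
    push Not at hno
    apply hT0sat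
    have hsat' : ((L.lhomWithConstants (Fin n)).onTheory T ∪
        Formula.equivSentence '' ({φ} ∪ BoundedFormula.not '' (↑Ψ₀ : Set _))).IsSatisfiable :=
      isSatisfiable_union_image_equivSentence_of_realize T _ M x (by
        rintro χ (rfl | ⟨ψ, hψ, rfl⟩)
        · exact hx
        · exact Formula.realize_not.2 (hno ψ hψ))
    refine hsat'.mono fun σ hσ => ?_
    rcases hT0 hσ with hσ' | ⟨χ, hχS, rfl⟩
    · exact Or.inl hσ'
    · refine Or.inr ⟨χ, ?_, rfl⟩
      rcases hχS with hχφ | ⟨ψ, hψ, rfl⟩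
      · exact Or.inl hχφ
      · refine Or.inr ⟨ψ, ?_, rfl⟩
        exact Finset.mem_filter.2 ⟨Finset.mem_preimage.2 (Finset.mem_preimage.2 hσ), hψ⟩
  -- the finite disjunction is `T`-equivalent to one existential formula
  obtain ⟨ε, hε, hiff⟩ := IsExistential.exists_iff_foldr_sup (T := T) Ψ₀.toList
    fun ψ hψ => (hΨ₀Ψ ψ (Finset.mem_toList.1 hψ)).1
  refine ⟨ε, hε, Theory.Iff.trans (fun M x xs => ?_) hiff⟩
  rw [realize_iff, realize_foldr_sup]
  obtain rfl : xs = default := Subsingleton.elim _ _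
  constructor
  · intro hx
    obtain ⟨ψ, hψ, hψx⟩ := cover M x hx
    exact ⟨ψ, Finset.mem_toList.2 hψ, hψx⟩
  · rintro ⟨ψ, hψ, hψx⟩
    exact (hΨ₀Ψ ψ (Finset.mem_toList.1 hψ)).2 M x default hψx

/-! ## Robinson's test -/

/-- **Robinson's test, direction `⇒`** (Marker 2002, Prop. 3.1.12; A. Robinson 1956): in a model
complete theory every formula is equivalent to an existential formula. [cite: Marker2002, Prop. 3.1.12] -/
theorem IsModelComplete.exists_isExistential_iff (h : T.IsModelComplete) (n : ℕ)
    (φ : L.Formula (Fin n)) : ∃ ψ : L.Formula (Fin n), ψ.IsExistential ∧ (φ ⇔[T] ψ) :=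
  exists_isExistential_iff_of_preserved φ (h.preservedUnderEmbeddings φ)

/-- **Robinson's test** (Marker 2002, Prop. 3.1.12): the named fact
`Theory.isModelComplete_iff_forall_exists_isExistential` of `ModelTheoryPreds.lean` holds — a
theory is model complete iff every formula is equivalent modulo the theory to an existential
formula. [cite: Marker2002, Prop. 3.1.12] -/
theorem isModelComplete_iff_forall_exists_isExistential_holds :
    isModelComplete_iff_forall_exists_isExistential (T := T) :=
  isModelComplete_iff_forall_exists_isExistential_of_mp IsModelComplete.exists_isExistential_iff

end FirstOrder.Language.Theory
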